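import Mathlib
import HarnessLib

/-!
# The Perron–Frobenius theorem for ground states (real symmetric matrices with nonpositive off-diagonal entries)

Trunk T-QLATTICE, family `hubbard`. The finite-dimensional Perron–Frobenius theorem in the form
in which it is used for lattice Hamiltonians: if `A` is a real symmetric matrix whose off-diagonal
entries are `≤ 0` and whose graph `{i ∼ j ⇔ A i j ≠ 0}` is connected, then the lowest
eigenvalue of `A` is simple and its eigenvector can be chosen entrywise strictly positive.
This is exactly the argument of Lieb–Wu, Physica A 321 (2003) 1 = arXiv:cond-mat/0207529, §2,
items 1.–2. (for the Hubbard chain, see `HubbardRingPerronFrobeniusProofs`), written for an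
abstract matrix: if `f` is a ground state then so is `|f|` (variational principle, the
off-diagonal terms only decrease), a nonnegative ground state is strictly positive (one `hop` at
a time along the connected graph), hence every real ground state is strictly positive or strictly
negative, and two ground states are proportional (a suitable combination would vanish somewhere).

Everything here is PROVED from Mathlib; there are no definitions. The matrices are complex
(`Matrix ι ι ℂ`, as the Hamiltonians of `HubbardWave0`) with real entries (`star (A i j) = A i j`);
vectors are `ι → ℂ` with the inner product `star v ⬝ᵥ w`; real vectors enter as
`fun i => ((r i : ℝ) : ℂ)`. "Ground state at energy `E`" is phrased, as in
`Literature.MathematicalPhysics.QuantumLattice.LiebThm1.lieb_core`, by a real number `E` bounding the quadratic form from below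
(`E ‖v‖² ≤ Re ⟨v, A v⟩` for all `v`) together with the eigenvalue equation `A v = E v`; such an
`E` is then the bottom of the spectrum.

## Main results

* `mulVec_eq_smul_of_energy_le` — the variational principle: a minimiser of the quadratic form of
  a Hermitian matrix is an eigenvector.
* `PerronFrobenius.pos_of_nonneg` — a nonnegative real ground state is strictly positive.
* `PerronFrobenius.pos_or_neg` — a real ground state is strictly positive or strictly negative.
* `perronFrobenius_groundState_pos` — every ground state is a complex multiple of an entrywise
  strictly positive vector.
* `perronFrobenius_groundState_unique` — ground states are unique up to scalars.

## References

* E. H. Lieb, F. Y. Wu, *The one-dimensional Hubbard model: a reminiscence*, Physica A 321 (2003)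
  1–27 = arXiv:cond-mat/0207529, §2, items 1.–2. and their proof (p. 4–5 of the arXiv version).
  [LiebWuPhysicaA2003]
* O. Perron, Math. Ann. 64 (1907) 248; G. Frobenius, S.-B. Preuss. Akad. Wiss. (1912) 456
  (the classical theorem for nonnegative matrices, of which this is the symmetric "`-A`" case).
-/

namespace Literature.MathematicalPhysics.QuantumLattice

open Matrix Finset
open scoped ComplexOrder

variable {ι : Type*} [Fintype ι]

/-! ### Quadratic forms of complex matrices on real vectors -/

namespace PerronFrobenius

/-- `Re ⟨r, r⟩ = Σ rᵢ²` for a real vector `r`. [folklore] -/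
theorem re_star_dotProduct_self_real (r : ι → ℝ) :
    (star (fun i => ((r i : ℝ) : ℂ)) ⬝ᵥ fun i => ((r i : ℝ) : ℂ)).re = ∑ i, r i * r i := by
  simp [dotProduct, Complex.re_sum]

/-- `Re ⟨r, A r⟩ = Σᵢⱼ Re(Aᵢⱼ) rᵢ rⱼ` for a real vector `r`. [folklore] -/
theorem re_star_dotProduct_mulVec_real (A : Matrix ι ι ℂ) (r : ι → ℝ) :
    (star (fun i => ((r i : ℝ) : ℂ)) ⬝ᵥ A *ᵥ fun i => ((r i : ℝ) : ℂ)).re =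
      ∑ i, ∑ j, (A i j).re * (r i * r j) := by
  simp only [dotProduct, mulVec, Pi.star_apply, Complex.star_def, Complex.conj_ofReal,
    Complex.re_sum, Finset.mul_sum, Complex.mul_re, Complex.ofReal_re, Complex.ofReal_im, mul_zero,
    sub_zero]
  refine Finset.sum_congr rfl fun i _ => Finset.sum_congr rfl fun j _ => ?_
  ring

/-- For a matrix with real entries and a real vector `r`, `(A r)ᵢ = Σⱼ Re(Aᵢⱼ) rⱼ` (a real
number). [folklore] -/
theorem mulVec_real_apply {A : Matrix ι ι ℂ} (hreal : ∀ i j, star (A i j) = A i j) (r : ι → ℝ)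
    (i : ι) : (A *ᵥ fun j => ((r j : ℝ) : ℂ)) i = ((∑ j, (A i j).re * r j : ℝ) : ℂ) := by
  simp only [mulVec, dotProduct]
  push_cast
  refine Finset.sum_congr rfl fun j _ => ?_
  have him : (A i j).im = 0 := Complex.conj_eq_iff_im.1 (hreal i j)
  congr 1
  exact Complex.ext (by simp) (by simp [him])

/-- For a matrix with real entries, the real part of `A v` is `A` applied to the real part of `v`.
[folklore] -/
theorem re_mulVec_apply {A : Matrix ι ι ℂ} (hreal : ∀ i j, star (A i j) = A i j) (v : ι → ℂ)
    (i : ι) : ((A *ᵥ v) i).re = ∑ j, (A i j).re * (v j).re := by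
  simp only [mulVec, dotProduct, Complex.re_sum, Complex.mul_re]
  refine Finset.sum_congr rfl fun j _ => ?_
  have him : (A i j).im = 0 := Complex.conj_eq_iff_im.1 (hreal i j)
  rw [him, zero_mul, sub_zero]

/-- For a matrix with real entries, the imaginary part of `A v` is `A` applied to the imaginary
part of `v`. [folklore] -/
theorem im_mulVec_apply {A : Matrix ι ι ℂ} (hreal : ∀ i j, star (A i j) = A i j) (v : ι → ℂ)
    (i : ι) : ((A *ᵥ v) i).im = ∑ j, (A i j).re * (v j).im := by
  simp only [mulVec, dotProduct, Complex.im_sum, Complex.mul_im]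
  refine Finset.sum_congr rfl fun j _ => ?_
  have him : (A i j).im = 0 := Complex.conj_eq_iff_im.1 (hreal i j)
  rw [him, zero_mul, add_zero]

/-- The eigenvalue equation for a real vector and a matrix with real entries, in real terms:
`A r = E r ↔ ∀ i, Σⱼ Re(Aᵢⱼ) rⱼ = E rᵢ`. [folklore] -/
theorem mulVec_real_eq_smul_iff {A : Matrix ι ι ℂ} (hreal : ∀ i j, star (A i j) = A i j)
    (E : ℝ) (r : ι → ℝ) :
    (A *ᵥ fun j => ((r j : ℝ) : ℂ)) = (E : ℂ) • (fun j => ((r j : ℝ) : ℂ)) ↔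
      ∀ i, ∑ j, (A i j).re * r j = E * r i := by
  constructor
  · intro h i
    have := congrFun h i
    rw [mulVec_real_apply hreal, Pi.smul_apply, smul_eq_mul] at this
    exact_mod_cast this
  · intro h
    funext i
    rw [mulVec_real_apply hreal, Pi.smul_apply, smul_eq_mul, h i]
    push_cast
    rfl

/-- A complex eigenvector of a matrix with real entries for a real eigenvalue has real and
imaginary parts which are (real) eigenvectors. [folklore] -/
theorem mulVec_re_eq_smul {A : Matrix ι ι ℂ} (hreal : ∀ i j, star (A i j) = A i j) {E : ℝ}
    {v : ι → ℂ} (hv : A *ᵥ v = (E : ℂ) • v) :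
    (A *ᵥ fun j => (((v j).re : ℝ) : ℂ)) = (E : ℂ) • fun j => (((v j).re : ℝ) : ℂ) := by
  rw [mulVec_real_eq_smul_iff hreal]
  intro i
  have := congrArg Complex.re (congrFun hv i)
  rw [re_mulVec_apply hreal, Pi.smul_apply, smul_eq_mul, Complex.re_ofReal_mul] at this
  exact this

/-- Imaginary-part companion of `mulVec_re_eq_smul`. [folklore] -/
theorem mulVec_im_eq_smul {A : Matrix ι ι ℂ} (hreal : ∀ i j, star (A i j) = A i j) {E : ℝ}
    {v : ι → ℂ} (hv : A *ᵥ v = (E : ℂ) • v) :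
    (A *ᵥ fun j => (((v j).im : ℝ) : ℂ)) = (E : ℂ) • fun j => (((v j).im : ℝ) : ℂ) := by
  rw [mulVec_real_eq_smul_iff hreal]
  intro i
  have := congrArg Complex.im (congrFun hv i)
  rw [im_mulVec_apply hreal, Pi.smul_apply, smul_eq_mul, Complex.im_ofReal_mul] at this
  exact this

/-- Real linear combinations of real eigenvectors: `A (s - c r) = E (s - c r)`. [folklore] -/
theorem mulVec_real_sub_smul {A : Matrix ι ι ℂ} (hreal : ∀ i j, star (A i j) = A i j) {E : ℝ}
    {r s : ι → ℝ} (hr : (A *ᵥ fun j => ((r j : ℝ) : ℂ)) = (E : ℂ) • fun j => ((r j : ℝ) : ℂ))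
    (hs : (A *ᵥ fun j => ((s j : ℝ) : ℂ)) = (E : ℂ) • fun j => ((s j : ℝ) : ℂ)) (c : ℝ) :
    (A *ᵥ fun j => (((s - c • r) j : ℝ) : ℂ)) = (E : ℂ) • fun j => (((s - c • r) j : ℝ) : ℂ) := by
  rw [mulVec_real_eq_smul_iff hreal] at hr hs ⊢
  intro i
  simp only [Pi.sub_apply, Pi.smul_apply, smul_eq_mul, mul_sub, Finset.sum_sub_distrib]
  rw [hs i]
  have : ∑ j, (A i j).re * (c * r j) = c * (E * r i) := by
    rw [← hr i, Finset.mul_sum]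
    exact Finset.sum_congr rfl fun j _ => by ring
  rw [this]
  ring

end PerronFrobenius

/-! ### The variational principle -/

/-- **Variational principle** (finite-dimensional): if the Hermitian matrix `A` satisfies
`E ‖v‖² ≤ Re ⟨v, A v⟩` for all `v` and `w` attains the bound, `Re ⟨w, A w⟩ ≤ E ‖w‖²`, then
`A w = E w`. (Expand `0 ≤ Re ⟨w + t z, (A - E)(w + t z)⟩` with `z = (A - E) w` and `t → 0⁻`.)
Tasaki (2020) §2.1; Lieb–Wu, Physica A 321 (2003) 1, §2 ("by the variational principle ... `g`
must be a ground state as well ... Therefore `g(X)` must satisfy (Gaudin) with the same `E₀`").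
[cite: LiebWuPhysicaA2003, §2] -/
theorem mulVec_eq_smul_of_energy_le {A : Matrix ι ι ℂ} (hA : Aᴴ = A) {E : ℝ}
    (hE : ∀ v : ι → ℂ, E * (star v ⬝ᵥ v).re ≤ (star v ⬝ᵥ A *ᵥ v).re) {w : ι → ℂ}
    (hw : (star w ⬝ᵥ A *ᵥ w).re ≤ E * (star w ⬝ᵥ w).re) : A *ᵥ w = (E : ℂ) • w := by
  -- the shifted operator `T v = A v - E v` is self-adjoint and nonnegative
  set T : (ι → ℂ) → (ι → ℂ) := fun v => A *ᵥ v - (E : ℂ) • v with hT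
  have hre : ∀ v v' : ι → ℂ, (star v ⬝ᵥ T v').re = (star v ⬝ᵥ A *ᵥ v').re - E * (star v ⬝ᵥ v').re := by
    intro v v'
    simp only [hT, dotProduct_sub, dotProduct_smul, smul_eq_mul, Complex.sub_re,
      Complex.re_ofReal_mul]
  have hTpos : ∀ v, 0 ≤ (star v ⬝ᵥ T v).re := fun v => by rw [hre]; linarith [hE v]
  have hTw : (star w ⬝ᵥ T w).re ≤ 0 := by rw [hre]; linarith
  -- self-adjointness: `⟨v, T v'⟩ = conj ⟨v', T v⟩`
  have hAsa : ∀ v v' : ι → ℂ, star v ⬝ᵥ A *ᵥ v' = star (star v' ⬝ᵥ A *ᵥ v) := by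
    intro v v'
    conv_rhs => rw [← star_dotProduct_star, star_star, star_mulVec, ← dotProduct_mulVec, hA]
  have hTsa : ∀ v v' : ι → ℂ, star v ⬝ᵥ T v' = star (star v' ⬝ᵥ T v) := by
    intro v v'
    simp only [hT, dotProduct_sub, dotProduct_smul, smul_eq_mul, star_sub, star_mul',
      Complex.star_def, Complex.conj_ofReal]
    rw [hAsa v v', star_dotProduct v v']
    rfl
  have hTadd : ∀ v v', T (v + v') = T v + T v' := by
    intro v v'
    simp only [hT, mulVec_add, smul_add]
    abel
  have hTsmul : ∀ (c : ℂ) (v), T (c • v) = c • T v := by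
    intro c v
    simp only [hT, mulVec_smul, smul_sub, smul_comm c (E : ℂ) v]
  set z := T w with hz
  have hzz : (star z ⬝ᵥ z).im = 0 :=
    (Complex.nonneg_iff.1 (dotProduct_star_self_nonneg z)).2.symm
  have hwTz : (star w ⬝ᵥ T z).re = (star z ⬝ᵥ z).re := by
    rw [hTsa, Complex.star_def, Complex.conj_re]
  -- expand `Re ⟨w + tz, T (w + tz)⟩ = Re ⟨w, T w⟩ + 2 t ‖z‖² + t² Re ⟨z, T z⟩` for real `t`
  have hexp : ∀ t : ℝ, (star (w + (t : ℂ) • z) ⬝ᵥ T (w + (t : ℂ) • z)).re =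
      (star w ⬝ᵥ T w).re + 2 * t * (star z ⬝ᵥ z).re + t ^ 2 * (star z ⬝ᵥ T z).re := by
    intro t
    rw [hTadd, hTsmul, star_add, star_smul, add_dotProduct, dotProduct_add, dotProduct_add,
      smul_dotProduct, smul_dotProduct, dotProduct_smul, dotProduct_smul, ← hz]
    simp only [smul_eq_mul, Complex.star_def, Complex.conj_ofReal, Complex.add_re,
      Complex.re_ofReal_mul, hwTz]
    ring
  set q := (star z ⬝ᵥ z).re with hq
  set c := (star z ⬝ᵥ T z).re with hc
  have hc0 : 0 ≤ c := hTpos z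
  have key := hTpos (w + ((-q / (c + 1) : ℝ) : ℂ) • z)
  rw [hexp] at key
  have hq0 : q = 0 := by
    have hc1 : (0 : ℝ) < c + 1 := by linarith
    have h1 : (star w ⬝ᵥ T w).re + 2 * (-q / (c + 1)) * q + (-q / (c + 1)) ^ 2 * c =
        (star w ⬝ᵥ T w).re - q ^ 2 * (c + 2) / (c + 1) ^ 2 := by
      field_simp
      ring
    rw [h1] at key
    have h3 : q ^ 2 * (c + 2) / (c + 1) ^ 2 ≤ 0 := by linarith
    rw [div_le_iff₀ (by positivity), zero_mul] at h3
    nlinarith [sq_nonneg q]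
  have hz0 : z = 0 := by
    have h : star z ⬝ᵥ z = 0 := Complex.ext (by simpa [hq] using hq0) (by simpa using hzz)
    exact dotProduct_star_self_eq_zero.1 h
  exact sub_eq_zero.1 hz0

/-! ### Perron–Frobenius: positivity and uniqueness of ground states -/

namespace PerronFrobenius

/-- The key inequality `Σᵢⱼ Re(Aᵢⱼ) |rᵢ| |rⱼ| ≤ Σᵢⱼ Re(Aᵢⱼ) rᵢ rⱼ` when the off-diagonal entries
have nonpositive real part ("`|f(X)| Ĥ(X,Y) |f(Y)| ≤ f(X) Ĥ(X,Y) f(Y)` for every `X, Y`").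
Lieb–Wu, Physica A 321 (2003) 1, §2, proof of item 2. [cite: LiebWuPhysicaA2003, §2] -/
theorem sum_abs_mul_abs_le {A : Matrix ι ι ℂ} (hoff : ∀ i j, i ≠ j → (A i j).re ≤ 0) (r : ι → ℝ) :
    ∑ i, ∑ j, (A i j).re * (|r i| * |r j|) ≤ ∑ i, ∑ j, (A i j).re * (r i * r j) := by
  refine Finset.sum_le_sum fun i _ => Finset.sum_le_sum fun j _ => ?_
  by_cases hij : i = j
  · subst hij
    rw [abs_mul_abs_self]
  · refine mul_le_mul_of_nonpos_left ?_ (hoff i j hij)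
    rw [← abs_mul]
    exact le_abs_self _

/-- **If `f` is a ground state, so is `|f|`.** For `A` with real entries, symmetric, with
nonpositive off-diagonal real parts, and `E` a lower bound of its quadratic form: if the real
vector `r` solves `A r = E r` then so does `|r|` (by `sum_abs_mul_abs_le`, `|r|` has energy at most
that of `r`, hence is a minimiser; by the variational principle it is an eigenvector).
Lieb–Wu, Physica A 321 (2003) 1, §2, proof of item 2. ("Hence `g` must be a ground state as well").
[cite: LiebWuPhysicaA2003, §2] -/
theorem mulVec_abs_eq_smul {A : Matrix ι ι ℂ} (hsymm : ∀ i j, A i j = A j i)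
    (hreal : ∀ i j, star (A i j) = A i j) (hoff : ∀ i j, i ≠ j → (A i j).re ≤ 0) {E : ℝ}
    (hE : ∀ v : ι → ℂ, E * (star v ⬝ᵥ v).re ≤ (star v ⬝ᵥ A *ᵥ v).re) {r : ι → ℝ}
    (hr : (A *ᵥ fun j => ((r j : ℝ) : ℂ)) = (E : ℂ) • fun j => ((r j : ℝ) : ℂ)) :
    (A *ᵥ fun j => ((|r j| : ℝ) : ℂ)) = (E : ℂ) • fun j => ((|r j| : ℝ) : ℂ) := by
  have hA : Aᴴ = A := by
    ext i j
    rw [conjTranspose_apply, hreal, hsymm]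
  refine mulVec_eq_smul_of_energy_le hA hE ?_
  -- energy of `|r|` ≤ energy of `r` = `E ‖r‖² = E ‖ |r| ‖²`
  have h1 : (star (fun j => ((r j : ℝ) : ℂ)) ⬝ᵥ A *ᵥ fun j => ((r j : ℝ) : ℂ)).re =
      E * ∑ i, r i * r i := by
    rw [hr, dotProduct_smul, smul_eq_mul, Complex.re_ofReal_mul, re_star_dotProduct_self_real]
  rw [re_star_dotProduct_mulVec_real, re_star_dotProduct_self_real]
  calc ∑ i, ∑ j, (A i j).re * (|r i| * |r j|)
      ≤ ∑ i, ∑ j, (A i j).re * (r i * r j) := sum_abs_mul_abs_le hoff r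
    _ = E * ∑ i, r i * r i := by rw [← re_star_dotProduct_mulVec_real, h1]
    _ = E * ∑ i, |r i| * |r i| := by simp only [abs_mul_abs_self]

/-- **A nonnegative ground state is strictly positive.** If `A` has real entries, nonpositive
off-diagonal real parts and a connected graph, a real solution `r ≥ 0`, `r ≠ 0` of `A r = E r`
has `rᵢ > 0` for all `i`: if `r(Y) = 0` then `Σ_Z A(Y,Z) r(Z) = 0` is a sum of nonpositive terms,
so `r(Z) = 0` for every `Z` one hop away, and tracing back along the connected graph `r ≡ 0`.
Lieb–Wu, Physica A 321 (2003) 1, §2, proof of item 2. [cite: LiebWuPhysicaA2003, §2] -/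
theorem pos_of_nonneg {A : Matrix ι ι ℂ} (hreal : ∀ i j, star (A i j) = A i j)
    (hoff : ∀ i j, i ≠ j → (A i j).re ≤ 0)
    (hconn : ∀ i j, Relation.ReflTransGen (fun a b => A a b ≠ 0) i j) {E : ℝ} {r : ι → ℝ}
    (hr0 : ∀ i, 0 ≤ r i) (hne : r ≠ 0)
    (hr : (A *ᵥ fun j => ((r j : ℝ) : ℂ)) = (E : ℂ) • fun j => ((r j : ℝ) : ℂ)) :
    ∀ i, 0 < r i := by
  rw [mulVec_real_eq_smul_iff hreal] at hr
  -- one hop: a zero propagates to the neighbours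
  have step : ∀ a b, A a b ≠ 0 → r a = 0 → r b = 0 := by
    intro a b hab ha
    by_cases hab' : a = b
    · exact hab' ▸ ha
    have hsum : ∑ j, (A a j).re * r j = 0 := by rw [hr a, ha, mul_zero]
    have hnonpos : ∀ j ∈ (univ : Finset ι), (A a j).re * r j ≤ 0 := by
      intro j _
      by_cases haj : a = j
      · subst haj
        rw [ha, mul_zero]
      · exact mul_nonpos_of_nonpos_of_nonneg (hoff a j haj) (hr0 j)
    have hb := (Finset.sum_eq_zero_iff_of_nonpos hnonpos).1 hsum b (mem_univ b)
    rcases mul_eq_zero.1 hb with h | h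
    · exfalso
      apply hab
      have him : (A a b).im = 0 := Complex.conj_eq_iff_im.1 (hreal a b)
      exact Complex.ext (by simpa using h) (by simpa using him)
    · exact h
  -- along chains of hops
  have chain : ∀ a b, Relation.ReflTransGen (fun a b => A a b ≠ 0) a b → r a = 0 → r b = 0 := by
    intro a b hab ha
    induction hab with
    | refl => exact ha
    | tail _ hbc ih => exact step _ _ hbc ih
  by_contra h
  simp only [not_forall, not_lt] at h
  obtain ⟨i, hi⟩ := h
  have hi0 : r i = 0 := le_antisymm hi (hr0 i)
  exact hne (funext fun j => chain i j (hconn i j) hi0)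

/-- **A real ground state is strictly positive or strictly negative.** Under the hypotheses of
`pos_of_nonneg` plus symmetry and the lower bound `E`: a real solution `r ≠ 0` of `A r = E r` has
all `rᵢ > 0` or all `rᵢ < 0` (`|r|` and `|r| - r` are nonnegative solutions, so each is `0` or
strictly positive). Lieb–Wu, Physica A 321 (2003) 1, §2, item 2. and its proof ("`f(X)` is a
strictly positive function in `R`"). [cite: LiebWuPhysicaA2003, §2, item 2] -/
theorem pos_or_neg {A : Matrix ι ι ℂ} (hsymm : ∀ i j, A i j = A j i)
    (hreal : ∀ i j, star (A i j) = A i j) (hoff : ∀ i j, i ≠ j → (A i j).re ≤ 0)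
    (hconn : ∀ i j, Relation.ReflTransGen (fun a b => A a b ≠ 0) i j) {E : ℝ}
    (hE : ∀ v : ι → ℂ, E * (star v ⬝ᵥ v).re ≤ (star v ⬝ᵥ A *ᵥ v).re) {r : ι → ℝ} (hne : r ≠ 0)
    (hr : (A *ᵥ fun j => ((r j : ℝ) : ℂ)) = (E : ℂ) • fun j => ((r j : ℝ) : ℂ)) :
    (∀ i, 0 < r i) ∨ (∀ i, r i < 0) := by
  -- `|r|` is a strictly positive ground state
  have habs := mulVec_abs_eq_smul hsymm hreal hoff hE hr
  have habs_ne : (fun j => |r j|) ≠ 0 := by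
    intro h
    apply hne
    funext j
    exact abs_eq_zero.1 (congrFun h j)
  have hpos := pos_of_nonneg hreal hoff hconn (fun j => abs_nonneg (r j)) habs_ne habs
  -- `|r| - r` is a nonnegative ground state
  have hdiff := mulVec_real_sub_smul hreal hr habs 1
  simp only [one_smul] at hdiff
  by_cases h0 : (fun j => |r j|) - r = 0
  · left
    intro i
    have hi : |r i| - r i = 0 := congrFun h0 i
    have h1 : 0 < |r i| := hpos i
    linarith
  · right
    have hpos' := pos_of_nonneg hreal hoff hconn (fun j => ?_) h0 hdiff
    · intro i
      have h1 := hpos' i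
      simp only [Pi.sub_apply, sub_pos] at h1
      by_contra h2
      rw [not_lt] at h2
      rw [abs_of_nonneg h2] at h1
      exact lt_irrefl _ h1
    · simp only [Pi.sub_apply, sub_nonneg]
      exact le_abs_self _

/-- **Uniqueness for real ground states.** Under the hypotheses of `pos_or_neg`, two real
solutions of `A r = E r`, `A s = E s` with `r ≠ 0` are proportional: `s - (s_{i₀}/r_{i₀}) r`
vanishes at `i₀`, hence identically. Lieb–Wu, Physica A 321 (2003) 1, §2, item 1. and its proof.
[cite: LiebWuPhysicaA2003, §2, item 1] -/
theorem exists_eq_smul_real {A : Matrix ι ι ℂ} (hsymm : ∀ i j, A i j = A j i)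
    (hreal : ∀ i j, star (A i j) = A i j) (hoff : ∀ i j, i ≠ j → (A i j).re ≤ 0)
    (hconn : ∀ i j, Relation.ReflTransGen (fun a b => A a b ≠ 0) i j) {E : ℝ}
    (hE : ∀ v : ι → ℂ, E * (star v ⬝ᵥ v).re ≤ (star v ⬝ᵥ A *ᵥ v).re) {r s : ι → ℝ} (hne : r ≠ 0)
    (hr : (A *ᵥ fun j => ((r j : ℝ) : ℂ)) = (E : ℂ) • fun j => ((r j : ℝ) : ℂ))
    (hs : (A *ᵥ fun j => ((s j : ℝ) : ℂ)) = (E : ℂ) • fun j => ((s j : ℝ) : ℂ)) :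
    ∃ c : ℝ, s = c • r := by
  obtain ⟨i₀, hi₀⟩ := Function.ne_iff.1 hne
  have hi₀' : r i₀ ≠ 0 := hi₀
  refine ⟨s i₀ / r i₀, ?_⟩
  have hk := mulVec_real_sub_smul hreal hr hs (s i₀ / r i₀)
  by_contra hks
  have hk0 : s - (s i₀ / r i₀) • r ≠ 0 := sub_ne_zero.2 hks
  have hki₀ : (s - (s i₀ / r i₀) • r) i₀ = 0 := by
    simp only [Pi.sub_apply, Pi.smul_apply, smul_eq_mul]
    rw [div_mul_cancel₀ (s i₀) hi₀', sub_self]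
  rcases pos_or_neg hsymm hreal hoff hconn hE hk0 hk with h | h
  · exact absurd hki₀ (h i₀).ne'
  · exact absurd hki₀ (h i₀).ne

/-- Every complex solution of `A v = E v` is a complex multiple of a given nonzero real one.
Lieb–Wu, Physica A 321 (2003) 1, §2 ("a ground state eigenfunction ... can be assumed to be
real"). [cite: LiebWuPhysicaA2003, §2] -/
theorem exists_eq_smul_of_real {A : Matrix ι ι ℂ} (hsymm : ∀ i j, A i j = A j i)
    (hreal : ∀ i j, star (A i j) = A i j) (hoff : ∀ i j, i ≠ j → (A i j).re ≤ 0)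
    (hconn : ∀ i j, Relation.ReflTransGen (fun a b => A a b ≠ 0) i j) {E : ℝ}
    (hE : ∀ v : ι → ℂ, E * (star v ⬝ᵥ v).re ≤ (star v ⬝ᵥ A *ᵥ v).re) {r : ι → ℝ} (hne : r ≠ 0)
    (hr : (A *ᵥ fun j => ((r j : ℝ) : ℂ)) = (E : ℂ) • fun j => ((r j : ℝ) : ℂ))
    {v : ι → ℂ} (hv : A *ᵥ v = (E : ℂ) • v) :
    ∃ c : ℂ, v = c • fun j => ((r j : ℝ) : ℂ) := by
  obtain ⟨a, ha⟩ := exists_eq_smul_real hsymm hreal hoff hconn hE hne hr (mulVec_re_eq_smul hreal hv)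
  obtain ⟨b, hb⟩ := exists_eq_smul_real hsymm hreal hoff hconn hE hne hr (mulVec_im_eq_smul hreal hv)
  refine ⟨(a : ℂ) + (b : ℂ) * Complex.I, funext fun j => ?_⟩
  have ha' : (v j).re = a * r j := by simpa using congrFun ha j
  have hb' : (v j).im = b * r j := by simpa using congrFun hb j
  rw [Pi.smul_apply, smul_eq_mul]
  apply Complex.ext
  · simp [ha']
  · simp [hb']

end PerronFrobenius

open PerronFrobenius

/-- **Perron–Frobenius theorem for ground states (positivity).** Let `A` be a complex matrix
with real entries (`star (A i j) = A i j`), symmetric, with nonpositive off-diagonal entries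
(`Re (A i j) ≤ 0` for `i ≠ j`) and connected graph `{i ∼ j ⇔ A i j ≠ 0}`, and let `E` be a lower
bound of its quadratic form (`E ‖v‖² ≤ Re ⟨v, A v⟩` for all `v`). Then every nonzero solution of
`A v = E v` (every ground state) is a complex multiple of an entrywise strictly positive real
vector. Lieb–Wu, Physica A 321 (2003) 1 = arXiv:cond-mat/0207529, §2, item 2. and its proof
(Perron–Frobenius argument in the region `R`). [cite: LiebWuPhysicaA2003, §2, item 2] -/
theorem perronFrobenius_groundState_pos {A : Matrix ι ι ℂ} (hsymm : ∀ i j, A i j = A j i)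
    (hreal : ∀ i j, star (A i j) = A i j) (hoff : ∀ i j, i ≠ j → (A i j).re ≤ 0)
    (hconn : ∀ i j, Relation.ReflTransGen (fun a b => A a b ≠ 0) i j) {E : ℝ}
    (hE : ∀ v : ι → ℂ, E * (star v ⬝ᵥ v).re ≤ (star v ⬝ᵥ A *ᵥ v).re) {v : ι → ℂ}
    (hv : A *ᵥ v = (E : ℂ) • v) (hv0 : v ≠ 0) :
    ∃ (c : ℂ) (r : ι → ℝ), (∀ i, 0 < r i) ∧ v = c • fun j => ((r j : ℝ) : ℂ) := by
  -- a nonzero real solution: the real or the imaginary part of `v`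
  obtain ⟨s, hs0, hs⟩ : ∃ s : ι → ℝ, s ≠ 0 ∧
      (A *ᵥ fun j => ((s j : ℝ) : ℂ)) = (E : ℂ) • fun j => ((s j : ℝ) : ℂ) := by
    by_cases hre : (fun j => (v j).re) = 0
    · refine ⟨fun j => (v j).im, fun him => hv0 (funext fun j => ?_), mulVec_im_eq_smul hreal hv⟩
      exact Complex.ext (congrFun hre j) (congrFun him j)
    · exact ⟨fun j => (v j).re, hre, mulVec_re_eq_smul hreal hv⟩
  -- make it positive
  obtain ⟨r, hrpos, hr⟩ : ∃ r : ι → ℝ, (∀ i, 0 < r i) ∧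
      (A *ᵥ fun j => ((r j : ℝ) : ℂ)) = (E : ℂ) • fun j => ((r j : ℝ) : ℂ) := by
    rcases pos_or_neg hsymm hreal hoff hconn hE hs0 hs with h | h
    · exact ⟨s, h, hs⟩
    · refine ⟨-s, fun i => by simpa using h i, ?_⟩
      have := mulVec_real_sub_smul hreal hs hs 2
      have e : s - (2 : ℝ) • s = -s := by
        funext j
        simp only [Pi.sub_apply, Pi.smul_apply, smul_eq_mul, Pi.neg_apply]
        ring
      rwa [e] at this
  have hι : Nonempty ι := by
    by_contra h
    rw [not_nonempty_iff] at h
    exact hv0 (funext fun i => (IsEmpty.false i).elim)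
  obtain ⟨i₀⟩ := hι
  have hrne : r ≠ 0 := Function.ne_iff.2 ⟨i₀, (hrpos i₀).ne'⟩
  obtain ⟨c, hc⟩ := exists_eq_smul_of_real hsymm hreal hoff hconn hE hrne hr hv
  exact ⟨c, r, hrpos, hc⟩

/-- **Perron–Frobenius theorem for ground states (uniqueness).** Under the hypotheses of
`perronFrobenius_groundState_pos`, the solutions of `A v = E v` form a space of dimension at most
one: any two, the first nonzero, are proportional ("There is only one ground state").
Lieb–Wu, Physica A 321 (2003) 1 = arXiv:cond-mat/0207529, §2, item 1. and its proof.
[cite: LiebWuPhysicaA2003, §2, item 1] -/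
theorem perronFrobenius_groundState_unique {A : Matrix ι ι ℂ} (hsymm : ∀ i j, A i j = A j i)
    (hreal : ∀ i j, star (A i j) = A i j) (hoff : ∀ i j, i ≠ j → (A i j).re ≤ 0)
    (hconn : ∀ i j, Relation.ReflTransGen (fun a b => A a b ≠ 0) i j) {E : ℝ}
    (hE : ∀ v : ι → ℂ, E * (star v ⬝ᵥ v).re ≤ (star v ⬝ᵥ A *ᵥ v).re) {v w : ι → ℂ}
    (hv : A *ᵥ v = (E : ℂ) • v) (hw : A *ᵥ w = (E : ℂ) • w) (hv0 : v ≠ 0) :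
    ∃ c : ℂ, w = c • v := by
  obtain ⟨c, r, hrpos, hc⟩ := perronFrobenius_groundState_pos hsymm hreal hoff hconn hE hv hv0
  have hι : Nonempty ι := by
    by_contra h
    rw [not_nonempty_iff] at h
    exact hv0 (funext fun i => (IsEmpty.false i).elim)
  obtain ⟨i₀⟩ := hι
  have hrne : r ≠ 0 := Function.ne_iff.2 ⟨i₀, (hrpos i₀).ne'⟩
  have hr : (A *ᵥ fun j => ((r j : ℝ) : ℂ)) = (E : ℂ) • fun j => ((r j : ℝ) : ℂ) := by
    have hc0 : c ≠ 0 := by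
      rintro rfl
      exact hv0 (by rw [hc, zero_smul])
    have h1 : (fun j => ((r j : ℝ) : ℂ)) = c⁻¹ • v := by
      rw [hc, smul_smul, inv_mul_cancel₀ hc0, one_smul]
    rw [h1, mulVec_smul, hv, smul_comm]
  obtain ⟨d, hd⟩ := exists_eq_smul_of_real hsymm hreal hoff hconn hE hrne hr hw
  have hc0 : c ≠ 0 := by
    rintro rfl
    exact hv0 (by rw [hc, zero_smul])
  refine ⟨d / c, ?_⟩
  rw [hd, hc, smul_smul, div_mul_cancel₀ d hc0]

/-- **Perron–Frobenius theorem for ground states (all amplitudes of one phase).** Under the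
hypotheses of `perronFrobenius_groundState_pos`, a nonzero solution of `A v = E v` has, after
multiplication by a suitable nonzero constant, all entries real and strictly positive.
Lieb–Wu, Physica A 321 (2003) 1, §2, items 1.–2. [cite: LiebWuPhysicaA2003, §2, items 1–2] -/
theorem perronFrobenius_groundState_smul_pos {A : Matrix ι ι ℂ} (hsymm : ∀ i j, A i j = A j i)
    (hreal : ∀ i j, star (A i j) = A i j) (hoff : ∀ i j, i ≠ j → (A i j).re ≤ 0)
    (hconn : ∀ i j, Relation.ReflTransGen (fun a b => A a b ≠ 0) i j) {E : ℝ}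
    (hE : ∀ v : ι → ℂ, E * (star v ⬝ᵥ v).re ≤ (star v ⬝ᵥ A *ᵥ v).re) {v : ι → ℂ}
    (hv : A *ᵥ v = (E : ℂ) • v) (hv0 : v ≠ 0) :
    ∃ c : ℂ, c ≠ 0 ∧ ∀ i, 0 < (c * v i).re ∧ (c * v i).im = 0 := by
  obtain ⟨c, r, hrpos, hc⟩ := perronFrobenius_groundState_pos hsymm hreal hoff hconn hE hv hv0
  have hc0 : c ≠ 0 := by
    rintro rfl
    exact hv0 (by rw [hc, zero_smul])
  refine ⟨c⁻¹, inv_ne_zero hc0, fun i => ?_⟩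
  have : c⁻¹ * v i = r i := by
    rw [hc, Pi.smul_apply, smul_eq_mul, ← mul_assoc, inv_mul_cancel₀ hc0, one_mul]
  rw [this]
  exact ⟨by simpa using hrpos i, by simp⟩

end Literature.MathematicalPhysics.QuantumLattice
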